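import Literature.NumberTheory.Rogawski1990.ArchSingularStableTransferOfInner     -- ★ p843392 (END): `archStableOrbitalIntegral_signed_eq_of_isArchInnerTransfer_of_pinned`
import Literature.NumberTheory.Rogawski1990.ArchSingularWitnessFamily              -- ★ p843611 (W4c): `exists_archSingularFamily_of_coherent_torusDatum`
import Literature.NumberTheory.Rogawski1990.ArchSingularPinnedReferenceFamily      -- ★ p843612 (W1-ref): `exists_pinned_reference_centralizer_family`
import Literature.NumberTheory.Rogawski1990.ArchSingularCentralizerPinsExist       -- ★ F0P3-p03 (g10) (W3-pins): `exists_pins_conj_coherent_telescope_all`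
import Literature.NumberTheory.Automorphic.ArchProductHaarReading                  -- ★ p842955: `exists_isHaarMeasure_eq_map_archPiEquivCM_symm_pi`
import Literature.NumberTheory.Automorphic.ArchCongruenceOrbitalTransport          -- ★ (T-d) FILE 1: `formCongr_map_mixedEmbedding_archFormOf_eq`, `coe_archCongrOfEq_apply`
import Literature.NumberTheory.Rogawski1990.ArchCentralDescentAssemblyKit         -- ★ `isMulRightInvariant_of_isHaarMeasure_archLocal_diagonal`
import Literature.NumberTheory.Rogawski1990.AdelicStableConjugacy                  -- ★ `archPart_cmDatum_toAdelic`
import HarnessLib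

/-!
# THE ARCHIMEDEAN HALF OF THE LETTER S1′: singular members `m_{G′,∞,s}`, `m_{G,∞,s}` in Weil form at the non-regular rational classes ((Q-∞)(Q-q∞)), with central masses one
# ((C1)-arch, (C1-q)) AND the signed singular stable transfer (ST-∞-s), ASSEMBLED («(W4d)»; Rogawski 1990 §1.7, §4.3, §8.2, Prop. 10.1.2 (b), §14.2, Lemma 14.5.2 (b))

Topic `NumberTheory/Rogawski1990`; namespace `Literature.NumberTheory.Rogawski1990`.  THEOREMS ONLY (no `def`, no instance, no notation, no axiom, no named fact, no `sorry`).
Cell `pub/hodgecm-mathlib`, ENGINE T1 (crux H413 = `stmt-HodgeConjecture-24833`); the (ST-∞) witness road, brick (W4d) = END OF THE ROAD (F0P3a-p07 (g9) with F0P3-p03 (g10); LEAD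
F0P3a-plan (g10) lane T9-8 (G)).  Count-neutral; HONEST LABEL: HC_CM is proved only modulo the printed citations until rung 0 closes; the finite-place conjuncts of S1′ ((Q-fin), (NORM),
(K7-s), the κ-block) are NOT here — this file pays the archimedean conjuncts only, inside the frame of ★ `TamagawaSingularMembersExist`.

WHAT.  **`exists_archSingularMembers`**: in the frame of S1′ — `H′` hermitian anisotropic, two-sided Haar measures `ν′` on `G′_∞ = U(H′)(L ⊗ ℝ)` and `ν` on `G_∞ = U(Φ₃)(L ⊗ ℝ)`,
the REGULAR archimedean families `m′, m` in Weil form with the compatibilities (C)(C′G) (★ `ArchCanonicalSingularMatrix` conjuncts 7, 8, 11, 12 verbatim), and RATIONAL diagonal frames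
`c(P)ᵀ·diag α′·P = H′` (Landherr), `c(Q)ᵀ·diag β·Q = Φ₃` (★ `formCongr_quasiSplitFrame_diagonal`) — THERE ARE families `mGis` on `G′_∞` and `mqis` on `G_∞` satisfying the five
archimedean conjuncts of S1′ TOKEN FOR TOKEN: (Q-∞), (Q-q∞), the archimedean half of (C1), (C1-q), and (ST-∞-s); the torus data `TsG, Tsq` of the two families are EXPORTED
((W′-s)(W-s): Weil form w.r.t. the frame's own `ν′, ν`; (INV′)(INV)) so that the (K7-s) assembly can NAME the built datum and state (J-val-K) `hK` about it (★ F0P3-p03's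
`atPoint_eq_inv_smul_topFormFamily_of_pinRatio`).
PROOF = the road: congruences `Ψ, Φ_A` (★ (T-d) FILE 1) + product-Haar readings (★ p842955) + reference pins (★ p843612) + ONE coherent pinned torus datum per carrier (★ F0P3-p03's
`exists_pins_conj_coherent_telescope_all`) + the witness families (★ p843611) + the END assembly (★ p843392).

## References
* [Rogawski1990] J. D. Rogawski, *Automorphic Representations of Unitary Groups in Three Variables*, Ann. of Math. Stud. 123 (1990), §1.7 p. 6; §4.3 (4.3.1) p. 43; §8.2 pp. 117–124;
  Prop. 10.1.2 (b) p. 146; §14.2 (14.2.1) p. 232; §14.5 Lemma 14.5.2 (b) pp. 238–239.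
* [Kottwitz1988] R. E. Kottwitz, *Tamagawa numbers*, Ann. of Math. 127 (1988), Prop. 2.
* [DeitmarEchterhoff2014] A. Deitmar, S. Echterhoff, *Principles of Harmonic Analysis*, 2nd ed. (2014), Thm. 1.5.3.
* [Landherr1936HermitianForms] W. Landherr, *Äquivalenz Hermitescher Formen über einem beliebigen algebraischen Zahlkörper*, Abh. Math. Sem. Hamburg 11 (1936).
-/

set_option autoImplicit false

noncomputable section

open MeasureTheory Measure Filter Topology NumberField NumberField.InfinitePlace NumberField.mixedEmbedding Equiv Function Set
open Literature.MeasureTheory.Group Literature.NumberTheory.Automorphic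
open Literature.NumberTheory.Automorphic.UnitaryGroup hiding hermForm
open Literature.AlgebraicGeometry.ShimuraVarieties (unitaryGroup hermForm)
open Literature.LinearAlgebra.Matrix
open scoped Matrix MatrixGroups Matrix.Norms.Operator ContDiff NNReal ENNReal

namespace Literature.NumberTheory.Rogawski1990

variable (L : Type) [Field L] [NumberField L] [IsCMField L] (H' : Matrix (Fin 3) (Fin 3) L)
  [iAH : MeasurableSpace (arch (↥(maximalRealSubfield L)) L (IsCMField.complexConj L) 3 H')] [iAHb : BorelSpace (arch (↥(maximalRealSubfield L)) L (IsCMField.complexConj L) 3 H')]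
  [iAG : MeasurableSpace (arch (↥(maximalRealSubfield L)) L (IsCMField.complexConj L) 3 (Matrix.of fun i j : Fin 3 => if i.val + j.val + 1 = 3 then (1 : L) else 0))]
  [iAGb : BorelSpace (arch (↥(maximalRealSubfield L)) L (IsCMField.complexConj L) 3 (Matrix.of fun i j : Fin 3 => if i.val + j.val + 1 = 3 then (1 : L) else 0))]
  [iQH : ∀ γ' : arch (↥(maximalRealSubfield L)) L (IsCMField.complexConj L) 3 H', MeasurableSpace (arch (↥(maximalRealSubfield L)) L (IsCMField.complexConj L) 3 H' ⧸ Subgroup.centralizer ({γ'} : Set _))]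
  [iQHb : ∀ γ' : arch (↥(maximalRealSubfield L)) L (IsCMField.complexConj L) 3 H', BorelSpace (arch (↥(maximalRealSubfield L)) L (IsCMField.complexConj L) 3 H' ⧸ Subgroup.centralizer ({γ'} : Set _))]
  [iQG : ∀ γ' : arch (↥(maximalRealSubfield L)) L (IsCMField.complexConj L) 3 (Matrix.of fun i j : Fin 3 => if i.val + j.val + 1 = 3 then (1 : L) else 0),
    MeasurableSpace (arch (↥(maximalRealSubfield L)) L (IsCMField.complexConj L) 3 (Matrix.of fun i j : Fin 3 => if i.val + j.val + 1 = 3 then (1 : L) else 0) ⧸ Subgroup.centralizer ({γ'} : Set _))]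
  [iQGb : ∀ γ' : arch (↥(maximalRealSubfield L)) L (IsCMField.complexConj L) 3 (Matrix.of fun i j : Fin 3 => if i.val + j.val + 1 = 3 then (1 : L) else 0),
    BorelSpace (arch (↥(maximalRealSubfield L)) L (IsCMField.complexConj L) 3 (Matrix.of fun i j : Fin 3 => if i.val + j.val + 1 = 3 then (1 : L) else 0) ⧸ Subgroup.centralizer ({γ'} : Set _))]

set_option maxHeartbeats 400000 in
open scoped Classical in
/-- **(W4d) THE ARCHIMEDEAN HALF OF S1′, ASSEMBLED — WITH THE TORUS DATA EXPORTED.**  See the module docstring: from the frame's REGULAR Weil data and rational diagonal frames of `H′` and `Φ₃`, singular families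
`mGis`, `mqis` WITH THEIR TORUS DATA `TsG`, `Tsq` (Weil form w.r.t. the frame's own `ν′`, `ν`; invariance of every member) and (Q-∞), (Q-q∞), the archimedean half
of (C1), (C1-q), (ST-∞-s) — the conjunct texts of ★ `TamagawaSingularMembersExist` token for token.
[cite: Rogawski1990, §1.7 p. 6; §4.3 (4.3.1) p. 43; §8.2 pp. 122–124; Prop. 10.1.2 (b) p. 146; §14.2 (14.2.1) p. 232; §14.5 Lemma 14.5.2 (b) pp. 238–239] [cite: Kottwitz1988, Prop. 2]
[cite: DeitmarEchterhoff2014, Thm. 1.5.3] -/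
theorem exists_archSingularMembers_withData
    (hherm : (H'.map (cmConjRingHom L))ᵀ = H') (hanis : ∀ x : Fin 3 → L, hermForm (cmConjRingHom L) H' x x = 0 → x = 0)
    -- rational diagonal frames
    (α' : Fin 3 → L) (P : GL (Fin 3) L) (hP : formCongr (cmConjRingHom L) P (Matrix.diagonal α') = H')
    (hα' : ∀ i, α' i ≠ 0) (hhermα : ∀ i, (IsCMField.complexConj L (α' i) : L) = α' i)
    (β : Fin 3 → L) (Q : GL (Fin 3) L) (hQ : formCongr (cmConjRingHom L) Q (Matrix.diagonal β) = (Matrix.of fun i j : Fin 3 => if i.val + j.val + 1 = 3 then (1 : L) else 0))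
    (hβ : ∀ i, β i ≠ 0) (hhermβ : ∀ i, (IsCMField.complexConj L (β i) : L) = β i)
    -- the REGULAR archimedean data of the frame in Weil form: (W′)(W)(C)(C′G)
    (ν' : Measure (arch (↥(maximalRealSubfield L)) L (IsCMField.complexConj L) 3 H')) (ν : Measure (arch (↥(maximalRealSubfield L)) L (IsCMField.complexConj L) 3 (Matrix.of fun i j : Fin 3 => if i.val + j.val + 1 = 3 then (1 : L) else 0)))
    [ν'.IsHaarMeasure] [ν'.IsMulRightInvariant] [ν.IsHaarMeasure] [ν.IsMulRightInvariant]
    (t' : ∀ γ' : arch (↥(maximalRealSubfield L)) L (IsCMField.complexConj L) 3 H', Measure (Subgroup.centralizer ({γ'} : Set (arch (↥(maximalRealSubfield L)) L (IsCMField.complexConj L) 3 H'))))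
    (t : ∀ γ : arch (↥(maximalRealSubfield L)) L (IsCMField.complexConj L) 3 (Matrix.of fun i j : Fin 3 => if i.val + j.val + 1 = 3 then (1 : L) else 0), Measure (Subgroup.centralizer ({γ} : Set (arch (↥(maximalRealSubfield L)) L (IsCMField.complexConj L) 3 (Matrix.of fun i j : Fin 3 => if i.val + j.val + 1 = 3 then (1 : L) else 0)))))
    (hd' : H'.det ≠ 0) (hd₃ : (Matrix.of fun i j : Fin 3 => if i.val + j.val + 1 = 3 then (1 : L) else 0).det ≠ 0)
    (hC : ∀ (γ₁ γ₂ : arch (↥(maximalRealSubfield L)) L (IsCMField.complexConj L) 3 (Matrix.of fun i j : Fin 3 => if i.val + j.val + 1 = 3 then (1 : L) else 0)) (h₁ : IsRegularElt (γ₁.val : GL (Fin 3) (mixedEmbedding.mixedSpace L)))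
      (hc : Corresponds (conjMixed (↥(maximalRealSubfield L)) L (IsCMField.complexConj L)) (archFormOf L 3 (Matrix.of fun i j : Fin 3 => if i.val + j.val + 1 = 3 then (1 : L) else 0)) (archFormOf L 3 (Matrix.of fun i j : Fin 3 => if i.val + j.val + 1 = 3 then (1 : L) else 0)) γ₁ γ₂),
      Measure.map ⇑(archStableCentralizerEquiv L hd₃ hd₃ hc h₁) (t γ₁) = t γ₂)
    (hC'G : ∀ (γ' : arch (↥(maximalRealSubfield L)) L (IsCMField.complexConj L) 3 H') (γ : arch (↥(maximalRealSubfield L)) L (IsCMField.complexConj L) 3 (Matrix.of fun i j : Fin 3 => if i.val + j.val + 1 = 3 then (1 : L) else 0)) (h' : IsRegularElt (γ'.val : GL (Fin 3) (mixedEmbedding.mixedSpace L)))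
      (hc : Corresponds (conjMixed (↥(maximalRealSubfield L)) L (IsCMField.complexConj L)) (archFormOf L 3 H') (archFormOf L 3 (Matrix.of fun i j : Fin 3 => if i.val + j.val + 1 = 3 then (1 : L) else 0)) γ' γ),
      Measure.map ⇑(archStableCentralizerEquiv L hd' hd₃ hc h') (t' γ') = t γ)
    (m' : OrbitalMeasureFamily (arch (↥(maximalRealSubfield L)) L (IsCMField.complexConj L) 3 H')) (m : OrbitalMeasureFamily (arch (↥(maximalRealSubfield L)) L (IsCMField.complexConj L) 3 (Matrix.of fun i j : Fin 3 => if i.val + j.val + 1 = 3 then (1 : L) else 0)))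
    (hW' : m'.IsQuotientOf (fun γ => IsRegularElt (γ.val : GL (Fin 3) (mixedEmbedding.mixedSpace L))) ν' t')
    (hW : m.IsQuotientOf (fun γ => IsRegularElt (γ.val : GL (Fin 3) (mixedEmbedding.mixedSpace L))) ν t) :
    ∃ (mGis : OrbitalMeasureFamily (arch (↥(maximalRealSubfield L)) L (IsCMField.complexConj L) 3 H')) (mqis : OrbitalMeasureFamily (arch (↥(maximalRealSubfield L)) L (IsCMField.complexConj L) 3 (Matrix.of fun i j : Fin 3 => if i.val + j.val + 1 = 3 then (1 : L) else 0)))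
      (TsG : ∀ γ : arch (↥(maximalRealSubfield L)) L (IsCMField.complexConj L) 3 H', Measure ↥(Subgroup.centralizer ({γ} : Set (arch (↥(maximalRealSubfield L)) L (IsCMField.complexConj L) 3 H'))))
      (Tsq : ∀ γ : arch (↥(maximalRealSubfield L)) L (IsCMField.complexConj L) 3 (Matrix.of fun i j : Fin 3 => if i.val + j.val + 1 = 3 then (1 : L) else 0), Measure ↥(Subgroup.centralizer ({γ} : Set (arch (↥(maximalRealSubfield L)) L (IsCMField.complexConj L) 3 (Matrix.of fun i j : Fin 3 => if i.val + j.val + 1 = 3 then (1 : L) else 0))))),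
      -- (W′-s)(W-s): Weil form w.r.t. the frame's OWN `ν′`, `ν`, torus data EXPORTED (so that (J-val-K)'s `hK` can be stated about THIS datum)
      mGis.IsQuotientOf (fun x : arch (↥(maximalRealSubfield L)) L (IsCMField.complexConj L) 3 H' => ∃ γ₀ : (cmDatum L 3 H').Rational, ¬ IsRegularElt (γ₀.val : GL (Fin 3) L) ∧
          Corresponds (conjMixed (↥(maximalRealSubfield L)) L (IsCMField.complexConj L)) (archFormOf L 3 H') (archFormOf L 3 H') (cmRationalToArch L 3 H' γ₀) x) ν' TsG ∧
      mqis.IsQuotientOf (fun x : arch (↥(maximalRealSubfield L)) L (IsCMField.complexConj L) 3 (Matrix.of fun i j : Fin 3 => if i.val + j.val + 1 = 3 then (1 : L) else 0) => ∃ γ₀ : (cmDatum L 3 H').Rational, ¬ IsRegularElt (γ₀.val : GL (Fin 3) L) ∧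
          Corresponds (conjMixed (↥(maximalRealSubfield L)) L (IsCMField.complexConj L)) (archFormOf L 3 H') (archFormOf L 3 (Matrix.of fun i j : Fin 3 => if i.val + j.val + 1 = 3 then (1 : L) else 0)) (cmRationalToArch L 3 H' γ₀) x) ν Tsq ∧
      -- (INV′)(INV): every member is invariant under conjugation
      (∀ q : ConjClasses (arch (↥(maximalRealSubfield L)) L (IsCMField.complexConj L) 3 H'),
        SMulInvariantMeasure (arch (↥(maximalRealSubfield L)) L (IsCMField.complexConj L) 3 H') (arch (↥(maximalRealSubfield L)) L (IsCMField.complexConj L) 3 H' ⧸ Subgroup.centralizer ({(Quotient.out q : arch (↥(maximalRealSubfield L)) L (IsCMField.complexConj L) 3 H')} : Set _)) (mGis q)) ∧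
      (∀ q : ConjClasses (arch (↥(maximalRealSubfield L)) L (IsCMField.complexConj L) 3 (Matrix.of fun i j : Fin 3 => if i.val + j.val + 1 = 3 then (1 : L) else 0)),
        SMulInvariantMeasure (arch (↥(maximalRealSubfield L)) L (IsCMField.complexConj L) 3 (Matrix.of fun i j : Fin 3 => if i.val + j.val + 1 = 3 then (1 : L) else 0))
          (arch (↥(maximalRealSubfield L)) L (IsCMField.complexConj L) 3 (Matrix.of fun i j : Fin 3 => if i.val + j.val + 1 = 3 then (1 : L) else 0) ⧸ Subgroup.centralizer ({(Quotient.out q : arch (↥(maximalRealSubfield L)) L (IsCMField.complexConj L) 3 (Matrix.of fun i j : Fin 3 => if i.val + j.val + 1 = 3 then (1 : L) else 0))} : Set _)) (mqis q)) ∧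
      -- (C1), archimedean half
      (∀ c : ConjClasses (cmDatum L 3 H').Rational,
        (∃ ζ : L, (((Quotient.out c).val : GL (Fin 3) L) : Matrix (Fin 3) (Fin 3) L) = ζ • (1 : Matrix (Fin 3) (Fin 3) L)) →
        mGis.atPoint (archPart (↥(maximalRealSubfield L)) L (IsCMField.complexConj L) 3 H' ((cmDatum L 3 H').toAdelic (Quotient.out c))) Set.univ = 1) ∧
      -- (C1-q)
      (∀ c : ConjClasses (cmDatum L 3 (Matrix.of fun i j : Fin 3 => if i.val + j.val + 1 = 3 then (1 : L) else 0)).Rational,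
        (∃ ζ : L, (((Quotient.out c).val : GL (Fin 3) L) : Matrix (Fin 3) (Fin 3) L) = ζ • (1 : Matrix (Fin 3) (Fin 3) L)) →
        mqis.atPoint (archPart (↥(maximalRealSubfield L)) L (IsCMField.complexConj L) 3 (Matrix.of fun i j : Fin 3 => if i.val + j.val + 1 = 3 then (1 : L) else 0) ((cmDatum L 3 (Matrix.of fun i j : Fin 3 => if i.val + j.val + 1 = 3 then (1 : L) else 0)).toAdelic (Quotient.out c))) Set.univ = 1) ∧
      -- (ST-∞-s)
      (∀ (a' : arch (↥(maximalRealSubfield L)) L (IsCMField.complexConj L) 3 H' → ℂ) (a : arch (↥(maximalRealSubfield L)) L (IsCMField.complexConj L) 3 (Matrix.of fun i j : Fin 3 => if i.val + j.val + 1 = 3 then (1 : L) else 0) → ℂ),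
        ArchSmooth L 3 H' a' → ArchSmooth L 3 (Matrix.of fun i j : Fin 3 => if i.val + j.val + 1 = 3 then (1 : L) else 0) a → IsArchInnerTransfer L H' m' m a' a →
        ∀ (γ₀ : (cmDatum L 3 H').Rational) (γ : (cmDatum L 3 (Matrix.of fun i j : Fin 3 => if i.val + j.val + 1 = 3 then (1 : L) else 0)).Rational) (e₁ e₂ : L),
          Corresponds (cmConjRingHom L) H' (Matrix.of fun i j : Fin 3 => if i.val + j.val + 1 = 3 then (1 : L) else 0) (γ₀ : unitaryGroup (cmConjRingHom L) H') (γ : unitaryGroup (cmConjRingHom L) (Matrix.of fun i j : Fin 3 => if i.val + j.val + 1 = 3 then (1 : L) else 0)) →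
          e₁ ≠ e₂ →
          ((((γ₀ : unitaryGroup (cmConjRingHom L) H').val : GL (Fin 3) L) : Matrix (Fin 3) (Fin 3) L) - e₁ • (1 : Matrix (Fin 3) (Fin 3) L)) *
            ((((γ₀ : unitaryGroup (cmConjRingHom L) H').val : GL (Fin 3) L) : Matrix (Fin 3) (Fin 3) L) - e₂ • (1 : Matrix (Fin 3) (Fin 3) L)) = 0 →
          (¬ ∃ ζ : L, (((γ₀ : unitaryGroup (cmConjRingHom L) H').val : GL (Fin 3) L) : Matrix (Fin 3) (Fin 3) L) = ζ • (1 : Matrix (Fin 3) (Fin 3) L)) →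
          archStableOrbitalIntegral L 3 H' mGis (fun x => kottwitzSignArchWeight L 3 H' (ConjClasses.mk x) * a' x) (cmRationalToArch L 3 H' γ₀) =
            archStableOrbitalIntegral L 3 (Matrix.of fun i j : Fin 3 => if i.val + j.val + 1 = 3 then (1 : L) else 0) mqis
              (fun x => kottwitzSignArchWeight L 3 (Matrix.of fun i j : Fin 3 => if i.val + j.val + 1 = 3 then (1 : L) else 0) (ConjClasses.mk x) * a x) (cmRationalToArch L 3 (Matrix.of fun i j : Fin 3 => if i.val + j.val + 1 = 3 then (1 : L) else 0) γ)) := by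
  classical
  -- Borel σ-algebras on the auxiliary carriers (they do not occur in the statement)
  obtain ⟨iGL, iGLb⟩ : ∃ i : MeasurableSpace (GL (Fin 3) ℂ), @BorelSpace (GL (Fin 3) ℂ) _ i := ⟨borel _, @BorelSpace.mk _ _ (borel _) rfl⟩
  obtain ⟨iAA, iAAb⟩ : ∃ i : MeasurableSpace (arch (↥(maximalRealSubfield L)) L (IsCMField.complexConj L) 3 (Matrix.diagonal α')), @BorelSpace _ _ i := ⟨borel _, @BorelSpace.mk _ _ (borel _) rfl⟩
  obtain ⟨iQA, iQAb⟩ : ∃ i : ∀ γ : arch (↥(maximalRealSubfield L)) L (IsCMField.complexConj L) 3 (Matrix.diagonal α'), MeasurableSpace (arch (↥(maximalRealSubfield L)) L (IsCMField.complexConj L) 3 (Matrix.diagonal α') ⧸ Subgroup.centralizer ({γ} : Set (arch (↥(maximalRealSubfield L)) L (IsCMField.complexConj L) 3 (Matrix.diagonal α')))),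
      ∀ γ, @BorelSpace _ _ (i γ) := ⟨fun _ => borel _, fun _ => @BorelSpace.mk _ _ (borel _) rfl⟩
  obtain ⟨iLA, iLAb⟩ : ∃ i : ∀ (v : {w : InfinitePlace L // IsComplex w}) (g : archLocal L 3 (Matrix.diagonal α') v), MeasurableSpace (archLocal L 3 (Matrix.diagonal α') v ⧸ Subgroup.centralizer ({g} : Set (archLocal L 3 (Matrix.diagonal α') v))),
      ∀ v g, @BorelSpace _ _ (i v g) := ⟨fun _ _ => borel _, fun _ _ => @BorelSpace.mk _ _ (borel _) rfl⟩
  obtain ⟨iAB, iABb⟩ : ∃ i : MeasurableSpace (arch (↥(maximalRealSubfield L)) L (IsCMField.complexConj L) 3 (Matrix.diagonal β)), @BorelSpace _ _ i := ⟨borel _, @BorelSpace.mk _ _ (borel _) rfl⟩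
  obtain ⟨iQB, iQBb⟩ : ∃ i : ∀ γ : arch (↥(maximalRealSubfield L)) L (IsCMField.complexConj L) 3 (Matrix.diagonal β), MeasurableSpace (arch (↥(maximalRealSubfield L)) L (IsCMField.complexConj L) 3 (Matrix.diagonal β) ⧸ Subgroup.centralizer ({γ} : Set (arch (↥(maximalRealSubfield L)) L (IsCMField.complexConj L) 3 (Matrix.diagonal β)))),
      ∀ γ, @BorelSpace _ _ (i γ) := ⟨fun _ => borel _, fun _ => @BorelSpace.mk _ _ (borel _) rfl⟩
  obtain ⟨iLB, iLBb⟩ : ∃ i : ∀ (v : {w : InfinitePlace L // IsComplex w}) (g : archLocal L 3 (Matrix.diagonal β) v), MeasurableSpace (archLocal L 3 (Matrix.diagonal β) v ⧸ Subgroup.centralizer ({g} : Set (archLocal L 3 (Matrix.diagonal β) v))),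
      ∀ v g, @BorelSpace _ _ (i v g) := ⟨fun _ _ => borel _, fun _ _ => @BorelSpace.mk _ _ (borel _) rfl⟩
  -- the reference wall `z₁_w = (1, −1, 1)` (only its normal form matters: keep it opaque)
  obtain ⟨z₁, h02, h01⟩ : ∃ z₁ : {w : InfinitePlace L // IsComplex w} → Fin 3 → Circle, (∀ w, z₁ w 0 = z₁ w 2) ∧ (∀ w, z₁ w 0 ≠ z₁ w 1) := by
    refine ⟨fun _ => ![1, ⟨-1, mem_sphere_zero_iff_norm.mpr (by simp)⟩, 1], fun _ => rfl, fun _ h => ?_⟩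
    have h' := congrArg (fun z : Circle => (z : ℂ)) h
    norm_num at h'
  obtain ⟨iRA, iRAb⟩ : ∃ i : ∀ (v : {w : InfinitePlace L // IsComplex w}) (τ : Perm (Fin 3)), MeasurableSpace (archLocal L 3 (Matrix.diagonal (α' ∘ ⇑τ)) v ⧸ Subgroup.centralizer
      ({(⟨circleDiagonal 3 (z₁ v), circleDiagonal_mem_archLocal_diagonal L 3 (α' ∘ ⇑τ) v (z₁ v)⟩ : archLocal L 3 (Matrix.diagonal (α' ∘ ⇑τ)) v)} : Set (archLocal L 3 (Matrix.diagonal (α' ∘ ⇑τ)) v))),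
      ∀ v τ, @BorelSpace _ _ (i v τ) := ⟨fun _ _ => borel _, fun _ _ => @BorelSpace.mk _ _ (borel _) rfl⟩
  obtain ⟨iRB, iRBb⟩ : ∃ i : ∀ (v : {w : InfinitePlace L // IsComplex w}) (τ : Perm (Fin 3)), MeasurableSpace (archLocal L 3 (Matrix.diagonal (β ∘ ⇑τ)) v ⧸ Subgroup.centralizer
      ({(⟨circleDiagonal 3 (z₁ v), circleDiagonal_mem_archLocal_diagonal L 3 (β ∘ ⇑τ) v (z₁ v)⟩ : archLocal L 3 (Matrix.diagonal (β ∘ ⇑τ)) v)} : Set (archLocal L 3 (Matrix.diagonal (β ∘ ⇑τ)) v))),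
      ∀ v τ, @BorelSpace _ _ (i v τ) := ⟨fun _ _ => borel _, fun _ _ => @BorelSpace.mk _ _ (borel _) rfl⟩
  -- ===== carrier `U(diag α')`: congruence, product-Haar reading, reference pins, one-stop pins, the witness family =====
  let Ψ : arch (↥(maximalRealSubfield L)) L (IsCMField.complexConj L) 3 H' ≃ₜ* arch (↥(maximalRealSubfield L)) L (IsCMField.complexConj L) 3 (Matrix.diagonal α') :=
    unitaryGroupOfFormCongrOfEq (conjMixed (↥(maximalRealSubfield L)) L (IsCMField.complexConj L)) (Matrix.GeneralLinearGroup.map (mixedEmbedding L) P)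
      (archFormOf L 3 (Matrix.diagonal α')) (archFormOf L 3 H') (formCongr_map_mixedEmbedding_archFormOf_eq L hP)
  have hΨ : ∀ g : arch (↥(maximalRealSubfield L)) L (IsCMField.complexConj L) 3 H', ((Ψ g : arch (↥(maximalRealSubfield L)) L (IsCMField.complexConj L) 3 (Matrix.diagonal α')) : GL (Fin 3) (mixedSpace L)) =
      Matrix.GeneralLinearGroup.map (mixedEmbedding L) P * (g : GL (Fin 3) (mixedSpace L)) * (Matrix.GeneralLinearGroup.map (mixedEmbedding L) P)⁻¹ := fun _ => rfl
  have hSA := formCongr_map_mixedEmbedding_archFormOf_eq L hP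
  haveI : (ν'.map Ψ).IsHaarMeasure := ContinuousMulEquiv.isHaarMeasure_map ν' Ψ
  obtain ⟨νwA, hνwAH, hνA⟩ := exists_isHaarMeasure_eq_map_archPiEquivCM_symm_pi L 3 α' (ν'.map Ψ)
  have hνwA : ∀ v, (νwA v).IsHaarMeasure ∧ (νwA v).IsMulRightInvariant := fun v =>
    ⟨hνwAH v, by haveI := hνwAH v; exact isMulRightInvariant_of_isHaarMeasure_archLocal_diagonal L α' hα' hhermα v (νwA v)⟩
  have hrealA : ∀ (w : {w : InfinitePlace L // IsComplex w}) (i : Fin 3), (w.1.embedding (α' i)).im = 0 := fun w => im_embedding_diagonal_eq_zero L 3 α' hhermα w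
  obtain ⟨νHA, hνHA, hpinA, hT02A, hT01A⟩ := exists_pinned_reference_centralizer_family L α' hα' hrealA z₁ h02 h01 νwA hνwA
  obtain ⟨ρZA, ρPA, ρ'A, TA, hρZiA, hρZA, hρZ1A, hρPiA, hρPA, hρ'iA, hρ'A, hTA, -, hTiA, hcohA⟩ :=
    exists_pins_conj_coherent_telescope_all L α' hα' hrealA z₁ h02 h01 νHA hνHA hT02A hT01A
      (κ := {z0 : {w : InfinitePlace L // IsComplex w} → Fin 3 → Circle // ∀ w, z0 w 0 = z0 w 2 ∧ z0 w 0 ≠ z0 w 1}) Subtype.val (fun k w => k.2 w) Subtype.val_injective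
  haveI iHA : ((Measure.pi νwA).map (archPiEquivCM 3 L (Matrix.diagonal α')).symm).IsHaarMeasure := hνA ▸ inferInstance
  haveI iHAr : ((Measure.pi νwA).map (archPiEquivCM 3 L (Matrix.diagonal α')).symm).IsMulRightInvariant :=
    hνA ▸ UnitaryGroup.isMulRightInvariant_map_continuousMulEquiv Ψ ν'
  obtain ⟨mGis, TsA, hQA, hinvA, hcenA, hpinWA⟩ := exists_archSingularFamily_of_coherent_torusDatum L H' α' (Matrix.GeneralLinearGroup.map (mixedEmbedding L) P)
    Ψ hΨ hherm hanis hα' hhermα ν' ((Measure.pi νwA).map (archPiEquivCM 3 L (Matrix.diagonal α')).symm) hνA.symm TA hTiA hcohA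
  -- ===== carrier `U(diag β)`: congruence, product-Haar reading, reference pins, one-stop pins, the witness family =====
  let Φ_A : arch (↥(maximalRealSubfield L)) L (IsCMField.complexConj L) 3 (Matrix.of fun i j : Fin 3 => if i.val + j.val + 1 = 3 then (1 : L) else 0) ≃ₜ* arch (↥(maximalRealSubfield L)) L (IsCMField.complexConj L) 3 (Matrix.diagonal β) :=
    unitaryGroupOfFormCongrOfEq (conjMixed (↥(maximalRealSubfield L)) L (IsCMField.complexConj L)) (Matrix.GeneralLinearGroup.map (mixedEmbedding L) Q)
      (archFormOf L 3 (Matrix.diagonal β)) (archFormOf L 3 (Matrix.of fun i j : Fin 3 => if i.val + j.val + 1 = 3 then (1 : L) else 0)) (formCongr_map_mixedEmbedding_archFormOf_eq L hQ)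
  have hΦ_A : ∀ g : arch (↥(maximalRealSubfield L)) L (IsCMField.complexConj L) 3 (Matrix.of fun i j : Fin 3 => if i.val + j.val + 1 = 3 then (1 : L) else 0), ((Φ_A g : arch (↥(maximalRealSubfield L)) L (IsCMField.complexConj L) 3 (Matrix.diagonal β)) : GL (Fin 3) (mixedSpace L)) =
      Matrix.GeneralLinearGroup.map (mixedEmbedding L) Q * (g : GL (Fin 3) (mixedSpace L)) * (Matrix.GeneralLinearGroup.map (mixedEmbedding L) Q)⁻¹ := fun _ => rfl
  have hSB := formCongr_map_mixedEmbedding_archFormOf_eq L hQ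
  haveI : (ν.map Φ_A).IsHaarMeasure := ContinuousMulEquiv.isHaarMeasure_map ν Φ_A
  obtain ⟨νwB, hνwBH, hνB⟩ := exists_isHaarMeasure_eq_map_archPiEquivCM_symm_pi L 3 β (ν.map Φ_A)
  have hνwB : ∀ v, (νwB v).IsHaarMeasure ∧ (νwB v).IsMulRightInvariant := fun v =>
    ⟨hνwBH v, by haveI := hνwBH v; exact isMulRightInvariant_of_isHaarMeasure_archLocal_diagonal L β hβ hhermβ v (νwB v)⟩
  have hrealB : ∀ (w : {w : InfinitePlace L // IsComplex w}) (i : Fin 3), (w.1.embedding (β i)).im = 0 := fun w => im_embedding_diagonal_eq_zero L 3 β hhermβ w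
  obtain ⟨νHB, hνHB, hpinB, hT02B, hT01B⟩ := exists_pinned_reference_centralizer_family L β hβ hrealB z₁ h02 h01 νwB hνwB
  obtain ⟨ρZB, ρPB, ρ'B, TB, hρZiB, hρZB, hρZ1B, hρPiB, hρPB, hρ'iB, hρ'B, hTB, -, hTiB, hcohB⟩ :=
    exists_pins_conj_coherent_telescope_all L β hβ hrealB z₁ h02 h01 νHB hνHB hT02B hT01B
      (κ := {z0 : {w : InfinitePlace L // IsComplex w} → Fin 3 → Circle // ∀ w, z0 w 0 = z0 w 2 ∧ z0 w 0 ≠ z0 w 1}) Subtype.val (fun k w => k.2 w) Subtype.val_injective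
  haveI iHB : ((Measure.pi νwB).map (archPiEquivCM 3 L (Matrix.diagonal β)).symm).IsHaarMeasure := hνB ▸ inferInstance
  haveI iHBr : ((Measure.pi νwB).map (archPiEquivCM 3 L (Matrix.diagonal β)).symm).IsMulRightInvariant :=
    hνB ▸ UnitaryGroup.isMulRightInvariant_map_continuousMulEquiv Φ_A ν
  obtain ⟨mqis, TsB, hQB, hinvB, hcenB, hpinWB⟩ := exists_archSingularFamily_of_coherent_torusDatum L H' β (Matrix.GeneralLinearGroup.map (mixedEmbedding L) Q)
    Φ_A hΦ_A hherm hanis hβ hhermβ ν ((Measure.pi νwB).map (archPiEquivCM 3 L (Matrix.diagonal β)).symm) hνB.symm TB hTiB hcohB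
  -- ===== (ST-∞-s) by ★ p843392; (Q-∞)(Q-q∞) and the central masses from ★ p843611 =====
  refine ⟨mGis, mqis, TsA, TsB, hQA, hQB, hinvA, hinvB, fun c hc => ?_, fun c hc => ?_, ?_⟩
  · obtain ⟨ζ, hζ⟩ := hc
    rw [archPart_cmDatum_toAdelic]
    exact hcenA (Quotient.out c) ζ hζ
  · obtain ⟨ζ, hζ⟩ := hc
    rw [archPart_cmDatum_toAdelic]
    exact hcenB (Quotient.out c) ζ hζ
  · -- ★ p843392, applied in stages (carrier α′ data, carrier β data, families, pins)
    have h1a := archStableOrbitalIntegral_signed_eq_of_isArchInnerTransfer_of_pinned L H' α' β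
      (iGL := iGL) (iGLb := iGLb) (iAH := iAH) (iAHb := iAHb) (iAG := iAG) (iAGb := iAGb) (iQH := iQH) (iQHb := iQHb) (iQG := iQG) (iQGb := iQGb)
      (iAα := iAA) (iAαb := iAAb) (iAβ := iAB) (iAβb := iABb) (iQα := iQA) (iQαb := iQAb) (iQβ := iQB) (iQβb := iQBb)
      (iLα := iLA) (iLαb := iLAb) (iLβ := iLB) (iLβb := iLBb) (iRα := iRA) (iRαb := iRAb) (iRβ := iRB) (iRβb := iRBb)
      hherm hanis ν' ν t' t hd' hd₃ hC hC'G m' m hW' hW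
    have h1b := h1a hα' hhermα hβ hhermβ (Matrix.GeneralLinearGroup.map (mixedEmbedding L) P) Ψ hΨ hSA (Matrix.GeneralLinearGroup.map (mixedEmbedding L) Q) Φ_A hΦ_A hSB
    have h1c := h1b νwA hνwA hνA νwB hνwB hνB h02 h01   -- (`z₁` was fixed by the named instance arguments)
    have h1d := h1c νHA hνHA
    have h1e := h1d
      (fun v τ => (νwA v).map (ContinuousMulEquiv.restrictSubgroup (GLn.conjEquiv (Matrix.GeneralLinearGroup.mkOfDetNeZero _ (det_monomial_one_ne_zero 3 τ)))
        (archLocal L 3 (Matrix.diagonal (α' ∘ ⇑τ)) v) (archLocal L 3 (Matrix.diagonal α') v) (mem_archLocal_comp_perm_iff_conj_mem L 3 α' v τ)).symm)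
    have hντiA : ∀ (v : {w : InfinitePlace L // IsComplex w}) (τ : Perm (Fin 3)),
        ((νwA v).map (ContinuousMulEquiv.restrictSubgroup (GLn.conjEquiv (Matrix.GeneralLinearGroup.mkOfDetNeZero _ (det_monomial_one_ne_zero 3 τ)))
          (archLocal L 3 (Matrix.diagonal (α' ∘ ⇑τ)) v) (archLocal L 3 (Matrix.diagonal α') v) (mem_archLocal_comp_perm_iff_conj_mem L 3 α' v τ)).symm).IsHaarMeasure ∧
        ((νwA v).map (ContinuousMulEquiv.restrictSubgroup (GLn.conjEquiv (Matrix.GeneralLinearGroup.mkOfDetNeZero _ (det_monomial_one_ne_zero 3 τ)))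
          (archLocal L 3 (Matrix.diagonal (α' ∘ ⇑τ)) v) (archLocal L 3 (Matrix.diagonal α') v) (mem_archLocal_comp_perm_iff_conj_mem L 3 α' v τ)).symm).IsMulRightInvariant := by
      intro v τ
      haveI := (hνwA v).1; haveI := (hνwA v).2
      exact ⟨ContinuousMulEquiv.isHaarMeasure_map (νwA v) _, isMulRightInvariant_map_relabel_symm L 3 α' v τ (νwA v)⟩
    have h1f := h1e hντiA rfl (fun _ _ => (-1 : ℂ))
    have h1 := h1f hpinA (fun _ _ _ => rfl)
    have h2 := h1 νHB hνHB
      (fun v τ => (νwB v).map (ContinuousMulEquiv.restrictSubgroup (GLn.conjEquiv (Matrix.GeneralLinearGroup.mkOfDetNeZero _ (det_monomial_one_ne_zero 3 τ)))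
        (archLocal L 3 (Matrix.diagonal (β ∘ ⇑τ)) v) (archLocal L 3 (Matrix.diagonal β) v) (mem_archLocal_comp_perm_iff_conj_mem L 3 β v τ)).symm)
      (fun v τ => by
        haveI := (hνwB v).1; haveI := (hνwB v).2
        exact ⟨ContinuousMulEquiv.isHaarMeasure_map (νwB v) _, isMulRightInvariant_map_relabel_symm L 3 β v τ (νwB v)⟩)
      rfl (fun _ _ => -1)
    have h3 := h2 hpinB (fun _ _ _ => rfl) mGis hinvA mqis hinvB
    -- ★ p843392's per-wall-point packages `hpinα`, `hpinβ`: the one-stop pins at `k := ⟨z0, hwall⟩ + ★ p843611's (PIN) clause read through `T (t(z0∘ρ)) = ρ′ k ρ`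
    refine h3 ?_ ?_
    · intro z0 hwall
      refine ⟨ρZA ⟨z0, hwall⟩, hρZiA ⟨z0, hwall⟩, ρPA ⟨z0, hwall⟩, hρPiA ⟨z0, hwall⟩, ρ'A ⟨z0, hwall⟩, hρ'iA ⟨z0, hwall⟩, hρZA ⟨z0, hwall⟩, fun v σ h => ?_,
        hρPA ⟨z0, hwall⟩, hρ'A ⟨z0, hwall⟩, fun ρ => ?_⟩
      · rw [hρZ1A ⟨z0, hwall⟩ v σ h]; simp
      · obtain ⟨h1, h2, hq⟩ := hpinWA z0 hwall ρ
        haveI := (hρ'iA ⟨z0, hwall⟩ ρ).1; haveI := (hρ'iA ⟨z0, hwall⟩ ρ).2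
        exact hq.trans (quotientMeasure_congr_measure _ _ _ _ (hTA ⟨z0, hwall⟩ ρ) _)
    · intro z0 hwall
      refine ⟨ρZB ⟨z0, hwall⟩, hρZiB ⟨z0, hwall⟩, ρPB ⟨z0, hwall⟩, hρPiB ⟨z0, hwall⟩, ρ'B ⟨z0, hwall⟩, hρ'iB ⟨z0, hwall⟩, hρZB ⟨z0, hwall⟩, fun v σ h => ?_,
        hρPB ⟨z0, hwall⟩, hρ'B ⟨z0, hwall⟩, fun ρ => ?_⟩
      · rw [hρZ1B ⟨z0, hwall⟩ v σ h]; simp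
      · obtain ⟨h1, h2, hq⟩ := hpinWB z0 hwall ρ
        haveI := (hρ'iB ⟨z0, hwall⟩ ρ).1; haveI := (hρ'iB ⟨z0, hwall⟩ ρ).2
        exact hq.trans (quotientMeasure_congr_measure _ _ _ _ (hTB ⟨z0, hwall⟩ ρ) _)


set_option maxHeartbeats 400000 in
/-- **(W4d) THE ARCHIMEDEAN HALF OF S1′ — LETTER SHAPE.**  The five archimedean conjuncts of ★ `TamagawaSingularMembersExist` ((Q-∞), (Q-q∞), the archimedean half of (C1), (C1-q),
(ST-∞-s)) TOKEN FOR TOKEN, read off ★ `exists_archSingularMembers_withData` (`νi := ν′`, `νq := ν`).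
[cite: Rogawski1990, §4.3 (4.3.1) p. 43; Prop. 10.1.2 (b) p. 146; §14.5 Lemma 14.5.2 (b) pp. 238–239] [cite: Kottwitz1988, Prop. 2] -/
theorem exists_archSingularMembers
    (hherm : (H'.map (cmConjRingHom L))ᵀ = H') (hanis : ∀ x : Fin 3 → L, hermForm (cmConjRingHom L) H' x x = 0 → x = 0)
    -- rational diagonal frames
    (α' : Fin 3 → L) (P : GL (Fin 3) L) (hP : formCongr (cmConjRingHom L) P (Matrix.diagonal α') = H')
    (hα' : ∀ i, α' i ≠ 0) (hhermα : ∀ i, (IsCMField.complexConj L (α' i) : L) = α' i)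
    (β : Fin 3 → L) (Q : GL (Fin 3) L) (hQ : formCongr (cmConjRingHom L) Q (Matrix.diagonal β) = (Matrix.of fun i j : Fin 3 => if i.val + j.val + 1 = 3 then (1 : L) else 0))
    (hβ : ∀ i, β i ≠ 0) (hhermβ : ∀ i, (IsCMField.complexConj L (β i) : L) = β i)
    -- the REGULAR archimedean data of the frame in Weil form: (W′)(W)(C)(C′G)
    (ν' : Measure (arch (↥(maximalRealSubfield L)) L (IsCMField.complexConj L) 3 H')) (ν : Measure (arch (↥(maximalRealSubfield L)) L (IsCMField.complexConj L) 3 (Matrix.of fun i j : Fin 3 => if i.val + j.val + 1 = 3 then (1 : L) else 0)))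
    [ν'.IsHaarMeasure] [ν'.IsMulRightInvariant] [ν.IsHaarMeasure] [ν.IsMulRightInvariant]
    (t' : ∀ γ' : arch (↥(maximalRealSubfield L)) L (IsCMField.complexConj L) 3 H', Measure (Subgroup.centralizer ({γ'} : Set (arch (↥(maximalRealSubfield L)) L (IsCMField.complexConj L) 3 H'))))
    (t : ∀ γ : arch (↥(maximalRealSubfield L)) L (IsCMField.complexConj L) 3 (Matrix.of fun i j : Fin 3 => if i.val + j.val + 1 = 3 then (1 : L) else 0), Measure (Subgroup.centralizer ({γ} : Set (arch (↥(maximalRealSubfield L)) L (IsCMField.complexConj L) 3 (Matrix.of fun i j : Fin 3 => if i.val + j.val + 1 = 3 then (1 : L) else 0)))))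
    (hd' : H'.det ≠ 0) (hd₃ : (Matrix.of fun i j : Fin 3 => if i.val + j.val + 1 = 3 then (1 : L) else 0).det ≠ 0)
    (hC : ∀ (γ₁ γ₂ : arch (↥(maximalRealSubfield L)) L (IsCMField.complexConj L) 3 (Matrix.of fun i j : Fin 3 => if i.val + j.val + 1 = 3 then (1 : L) else 0)) (h₁ : IsRegularElt (γ₁.val : GL (Fin 3) (mixedEmbedding.mixedSpace L)))
      (hc : Corresponds (conjMixed (↥(maximalRealSubfield L)) L (IsCMField.complexConj L)) (archFormOf L 3 (Matrix.of fun i j : Fin 3 => if i.val + j.val + 1 = 3 then (1 : L) else 0)) (archFormOf L 3 (Matrix.of fun i j : Fin 3 => if i.val + j.val + 1 = 3 then (1 : L) else 0)) γ₁ γ₂),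
      Measure.map ⇑(archStableCentralizerEquiv L hd₃ hd₃ hc h₁) (t γ₁) = t γ₂)
    (hC'G : ∀ (γ' : arch (↥(maximalRealSubfield L)) L (IsCMField.complexConj L) 3 H') (γ : arch (↥(maximalRealSubfield L)) L (IsCMField.complexConj L) 3 (Matrix.of fun i j : Fin 3 => if i.val + j.val + 1 = 3 then (1 : L) else 0)) (h' : IsRegularElt (γ'.val : GL (Fin 3) (mixedEmbedding.mixedSpace L)))
      (hc : Corresponds (conjMixed (↥(maximalRealSubfield L)) L (IsCMField.complexConj L)) (archFormOf L 3 H') (archFormOf L 3 (Matrix.of fun i j : Fin 3 => if i.val + j.val + 1 = 3 then (1 : L) else 0)) γ' γ),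
      Measure.map ⇑(archStableCentralizerEquiv L hd' hd₃ hc h') (t' γ') = t γ)
    (m' : OrbitalMeasureFamily (arch (↥(maximalRealSubfield L)) L (IsCMField.complexConj L) 3 H')) (m : OrbitalMeasureFamily (arch (↥(maximalRealSubfield L)) L (IsCMField.complexConj L) 3 (Matrix.of fun i j : Fin 3 => if i.val + j.val + 1 = 3 then (1 : L) else 0)))
    (hW' : m'.IsQuotientOf (fun γ => IsRegularElt (γ.val : GL (Fin 3) (mixedEmbedding.mixedSpace L))) ν' t')
    (hW : m.IsQuotientOf (fun γ => IsRegularElt (γ.val : GL (Fin 3) (mixedEmbedding.mixedSpace L))) ν t) :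
    ∃ (mGis : OrbitalMeasureFamily (arch (↥(maximalRealSubfield L)) L (IsCMField.complexConj L) 3 H')) (mqis : OrbitalMeasureFamily (arch (↥(maximalRealSubfield L)) L (IsCMField.complexConj L) 3 (Matrix.of fun i j : Fin 3 => if i.val + j.val + 1 = 3 then (1 : L) else 0))),
      -- (Q-∞)
      (∃ (νi : Measure (arch (↥(maximalRealSubfield L)) L (IsCMField.complexConj L) 3 H')) (_ : νi.IsHaarMeasure) (_ : νi.IsMulRightInvariant)
          (tGi : ∀ γ : arch (↥(maximalRealSubfield L)) L (IsCMField.complexConj L) 3 H', Measure ↥(Subgroup.centralizer ({γ} : Set (arch (↥(maximalRealSubfield L)) L (IsCMField.complexConj L) 3 H')))),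
        mGis.IsQuotientOf (fun x : arch (↥(maximalRealSubfield L)) L (IsCMField.complexConj L) 3 H' => ∃ γ₀ : (cmDatum L 3 H').Rational, ¬ IsRegularElt (γ₀.val : GL (Fin 3) L) ∧
          Corresponds (conjMixed (↥(maximalRealSubfield L)) L (IsCMField.complexConj L)) (archFormOf L 3 H') (archFormOf L 3 H') (cmRationalToArch L 3 H' γ₀) x) νi tGi) ∧
      -- (Q-q∞)
      (∃ (νq : Measure (arch (↥(maximalRealSubfield L)) L (IsCMField.complexConj L) 3 (Matrix.of fun i j : Fin 3 => if i.val + j.val + 1 = 3 then (1 : L) else 0))) (_ : νq.IsHaarMeasure) (_ : νq.IsMulRightInvariant)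
          (tqi : ∀ γ : arch (↥(maximalRealSubfield L)) L (IsCMField.complexConj L) 3 (Matrix.of fun i j : Fin 3 => if i.val + j.val + 1 = 3 then (1 : L) else 0), Measure ↥(Subgroup.centralizer ({γ} : Set (arch (↥(maximalRealSubfield L)) L (IsCMField.complexConj L) 3 (Matrix.of fun i j : Fin 3 => if i.val + j.val + 1 = 3 then (1 : L) else 0))))),
        mqis.IsQuotientOf (fun x : arch (↥(maximalRealSubfield L)) L (IsCMField.complexConj L) 3 (Matrix.of fun i j : Fin 3 => if i.val + j.val + 1 = 3 then (1 : L) else 0) => ∃ γ₀ : (cmDatum L 3 H').Rational, ¬ IsRegularElt (γ₀.val : GL (Fin 3) L) ∧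
          Corresponds (conjMixed (↥(maximalRealSubfield L)) L (IsCMField.complexConj L)) (archFormOf L 3 H') (archFormOf L 3 (Matrix.of fun i j : Fin 3 => if i.val + j.val + 1 = 3 then (1 : L) else 0)) (cmRationalToArch L 3 H' γ₀) x) νq tqi) ∧
      -- (C1), archimedean half
      (∀ c : ConjClasses (cmDatum L 3 H').Rational,
        (∃ ζ : L, (((Quotient.out c).val : GL (Fin 3) L) : Matrix (Fin 3) (Fin 3) L) = ζ • (1 : Matrix (Fin 3) (Fin 3) L)) →
        mGis.atPoint (archPart (↥(maximalRealSubfield L)) L (IsCMField.complexConj L) 3 H' ((cmDatum L 3 H').toAdelic (Quotient.out c))) Set.univ = 1) ∧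
      -- (C1-q)
      (∀ c : ConjClasses (cmDatum L 3 (Matrix.of fun i j : Fin 3 => if i.val + j.val + 1 = 3 then (1 : L) else 0)).Rational,
        (∃ ζ : L, (((Quotient.out c).val : GL (Fin 3) L) : Matrix (Fin 3) (Fin 3) L) = ζ • (1 : Matrix (Fin 3) (Fin 3) L)) →
        mqis.atPoint (archPart (↥(maximalRealSubfield L)) L (IsCMField.complexConj L) 3 (Matrix.of fun i j : Fin 3 => if i.val + j.val + 1 = 3 then (1 : L) else 0) ((cmDatum L 3 (Matrix.of fun i j : Fin 3 => if i.val + j.val + 1 = 3 then (1 : L) else 0)).toAdelic (Quotient.out c))) Set.univ = 1) ∧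
      -- (ST-∞-s)
      (∀ (a' : arch (↥(maximalRealSubfield L)) L (IsCMField.complexConj L) 3 H' → ℂ) (a : arch (↥(maximalRealSubfield L)) L (IsCMField.complexConj L) 3 (Matrix.of fun i j : Fin 3 => if i.val + j.val + 1 = 3 then (1 : L) else 0) → ℂ),
        ArchSmooth L 3 H' a' → ArchSmooth L 3 (Matrix.of fun i j : Fin 3 => if i.val + j.val + 1 = 3 then (1 : L) else 0) a → IsArchInnerTransfer L H' m' m a' a →
        ∀ (γ₀ : (cmDatum L 3 H').Rational) (γ : (cmDatum L 3 (Matrix.of fun i j : Fin 3 => if i.val + j.val + 1 = 3 then (1 : L) else 0)).Rational) (e₁ e₂ : L),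
          Corresponds (cmConjRingHom L) H' (Matrix.of fun i j : Fin 3 => if i.val + j.val + 1 = 3 then (1 : L) else 0) (γ₀ : unitaryGroup (cmConjRingHom L) H') (γ : unitaryGroup (cmConjRingHom L) (Matrix.of fun i j : Fin 3 => if i.val + j.val + 1 = 3 then (1 : L) else 0)) →
          e₁ ≠ e₂ →
          ((((γ₀ : unitaryGroup (cmConjRingHom L) H').val : GL (Fin 3) L) : Matrix (Fin 3) (Fin 3) L) - e₁ • (1 : Matrix (Fin 3) (Fin 3) L)) *
            ((((γ₀ : unitaryGroup (cmConjRingHom L) H').val : GL (Fin 3) L) : Matrix (Fin 3) (Fin 3) L) - e₂ • (1 : Matrix (Fin 3) (Fin 3) L)) = 0 →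
          (¬ ∃ ζ : L, (((γ₀ : unitaryGroup (cmConjRingHom L) H').val : GL (Fin 3) L) : Matrix (Fin 3) (Fin 3) L) = ζ • (1 : Matrix (Fin 3) (Fin 3) L)) →
          archStableOrbitalIntegral L 3 H' mGis (fun x => kottwitzSignArchWeight L 3 H' (ConjClasses.mk x) * a' x) (cmRationalToArch L 3 H' γ₀) =
            archStableOrbitalIntegral L 3 (Matrix.of fun i j : Fin 3 => if i.val + j.val + 1 = 3 then (1 : L) else 0) mqis
              (fun x => kottwitzSignArchWeight L 3 (Matrix.of fun i j : Fin 3 => if i.val + j.val + 1 = 3 then (1 : L) else 0) (ConjClasses.mk x) * a x) (cmRationalToArch L 3 (Matrix.of fun i j : Fin 3 => if i.val + j.val + 1 = 3 then (1 : L) else 0) γ)) := by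
  obtain ⟨mGis, mqis, TsG, Tsq, hQG, hQq, -, -, hC1, hC1q, hST⟩ :=
    exists_archSingularMembers_withData L H' hherm hanis α' P hP hα' hhermα β Q hQ hβ hhermβ ν' ν t' t hd' hd₃ hC hC'G m' m hW' hW
  exact ⟨mGis, mqis, ⟨ν', inferInstance, inferInstance, TsG, hQG⟩, ⟨ν, inferInstance, inferInstance, Tsq, hQq⟩, hC1, hC1q, hST⟩

end Literature.NumberTheory.Rogawski1990

end
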